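import Summits.CriticalPhenomena.SAWScalingLimit.Theorems.SAWDevelopingMapObservableToSLETypeLadderCarvedReductionSqueezeLimitData
import Summits.CriticalPhenomena.SAWScalingLimit.Theorems.SAWDevelopingMapObservableToSLETypeLadderCarvedReductionSqueezeZonesSeq
import Summits.CriticalPhenomena.SAWScalingLimit.Theorems.SAWDevelopingMapObservableToSLETypeLadderCarvedReductionSqueezeOuterSeq
import HarnessLib

/-!
# The bulk and the outer sequence of the bundled limit data: vocabulary (piece (T-A′₂F outer data)
# of stub T-A′₂F `stub_carvedReduction_squeezeGeometry_domainsCoreF`)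

Crux `SAWDevelopingMap.ObservableToSLE` (stmt-CriticalPhenomena-10472), line `six-class-type-ladder`,
stub T-A′₂F `stub_carvedReduction_squeezeGeometry_domainsCoreF`.  Landing target:
`Summits/CriticalPhenomena/SAWScalingLimit/Theorems/SAWDevelopingMapObservableToSLETypeLadderCarvedReductionSqueezeOuterData.lean`.

Vocabulary over a `SqueezeLimit Λ`: the closed limit cells `Λ.XS`, `Λ.XT`, the pinned domain
`Λ.Dτ`, the base point `Λ.b₀ = P₀ + (ρ/256) i`, the bulk `Λ.Ω`, the gate/spine/body/cell/connector
families indexed by `Fin 2`; and the structure `SqueezeOuter Λ rs` bundling the chordal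
uniformizer of the super-domain, the compact convex family of the inner contract, the facts on
the bulk, the confined outer sequence `E_n` with the frame hypotheses (`outerSeq`), and the data
of the reach transfer (strip depths, swallowed closures, persistence margins).  No mathematics.
Registered carrier: `stub_carvedReduction_outerData`.
-/

noncomputable section

open scoped Topology
open Filter Set Metric
open Literature.Probability.LatticeModels (HexVertex hexGraph hexCenter triEmbed Site)
open Literature.Probability.RandomPlanarGeometry
open UpperHalfPlane (upperHalfPlaneSet)

namespace Summit.CriticalPhenomena.SAWScalingLimit.Theorems.ObservableToSLE.TypeLadder

open Summit.CriticalPhenomena.SAWScalingLimit.Theorems.ObservableToSLER.BridgeGate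

namespace SqueezeLimit

variable {D : DobrushinDomain} {a b : ℝ → HexVertex} {δ : ℕ → ℝ} {S T : ℕ → ℕ → Set HexVertex} {n n' : ℕ → ℕ}
  {q q' : ℕ → HexVertex} {κ : ℕ → ℕ} {ρ R : ℝ} {N : ℕ} (Λ : SqueezeLimit D a b δ S T n n' q q' κ ρ R N)

/-- The union of the closed limit cells of the `S`-side. -/
def XS : Set ℂ := ⋃ i, {z : ℂ | ∀ ℓ : Fin 3, |skewCoord ℓ (z - Λ.CS i)| ≤ Λ.ϱS i}

/-- The union of the closed limit cells of the `T`-side. -/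
def XT : Set ℂ := ⋃ i, {z : ℂ | ∀ ℓ : Fin 3, |skewCoord ℓ (z - Λ.CT i)| ≤ Λ.ϱT i}

/-- The pinned domain `D - τ`. -/
def Dτ : Set ℂ := (fun z => z - Λ.τ) '' D.carrier

/-- The base point `P₀ + (ρ/256) i`. -/
def b₀ : ℂ := Λ.P₀ + ((((ρ / 128) / 2 : ℝ)) : ℂ) * Complex.I

/-- The limit bulk. -/
def Ω : Set ℂ := connectedComponentIn (Λ.Dτ \ (Λ.XS ∪ Λ.XT)) Λ.b₀

/-- The gates. -/
def Pv : Fin 2 → ℂ := ![Λ.P₀, Λ.P₁]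

/-- The spines. -/
def Kspv : Fin 2 → Set ℂ := ![Λ.KS, Λ.KT]

/-- The bodies. -/
def Bdv : Fin 2 → Set ℂ := ![Λ.BS, Λ.BT]

/-- The cells. -/
def cellv : Fin 2 → Fin N → ℂ × ℝ := ![fun i => (Λ.CS i, Λ.ϱS i), fun i => (Λ.CT i, Λ.ϱT i)]

/-- The connectors. -/
def connv : Fin 2 → Fin N → ℂ × ℝ := ![fun i => (Λ.CcS i, Λ.ϱcS i), fun i => (Λ.CcT i, Λ.ϱcT i)]

/-- The compact convex family of the inner contract: the closed cells of both sides. -/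
def Kf : Fin (N + N) → Set ℂ :=
  Fin.addCases (fun i => {z : ℂ | ∀ ℓ : Fin 3, |skewCoord ℓ (z - Λ.CS i)| ≤ Λ.ϱS i})
    (fun i => {z : ℂ | ∀ ℓ : Fin 3, |skewCoord ℓ (z - Λ.CT i)| ≤ Λ.ϱT i})

/-- `⋃ k, Kf k = XS ∪ XT`. -/
theorem iUnion_Kf : (⋃ k, Λ.Kf k) = Λ.XS ∪ Λ.XT := by
  ext z
  simp only [mem_iUnion, XS, XT, mem_union]
  constructor
  · rintro ⟨k, hk⟩
    induction k using Fin.addCases with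
    | left i => rw [Kf, Fin.addCases_left] at hk; exact Or.inl ⟨i, hk⟩
    | right i => rw [Kf, Fin.addCases_right] at hk; exact Or.inr ⟨i, hk⟩
  · rintro (⟨i, hi⟩ | ⟨i, hi⟩)
    · exact ⟨Fin.castAdd N i, by rw [Kf, Fin.addCases_left]; exact hi⟩
    · exact ⟨Fin.natAdd N i, by rw [Kf, Fin.addCases_right]; exact hi⟩

end SqueezeLimit

/-- **The bulk, the outer sequence and the reach data of the bundled limit data**; see the module
docstring. -/
structure SqueezeOuter {D : DobrushinDomain} {a b : ℝ → HexVertex} {δ : ℕ → ℝ} {S T : ℕ → ℕ → Set HexVertex}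
    {n n' : ℕ → ℕ} {q q' : ℕ → HexVertex} {κ : ℕ → ℕ} {ρ R : ℝ} {N : ℕ}
    (Λ : SqueezeLimit D a b δ S T n n' q q' κ ρ R N) (rs : ℝ) where
  /-- the chordal uniformizer of the super-domain -/
  φ : ConformalEquiv upperHalfPlaneSet Λ.E.carrier
  /-- the outer approximants -/
  En : ℕ → DobrushinDomain
  /-- the swallowed closures -/
  Zc : ℕ → Set ℂ
  /-- the strip depths -/
  tz : ℕ → ℝ
  hφ : Λ.E.IsChordalUniformizing φ
  -- the family of the inner contract
  hKf : ∀ k, IsCompact (Λ.Kf k) ∧ Convex ℝ (Λ.Kf k)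
  hKfball : ∀ k, Λ.Kf k ⊆ ⋃ i : Fin 2, ball (D.pt i - Λ.τ) (rs / 2)
  -- the bulk
  hΩo : IsOpen Λ.Ω
  hΩc : IsConnected Λ.Ω
  hwin : ∀ i : Fin 2, {z : ℂ | (Λ.Pv i).im < z.im} ∩ ball (Λ.Pv i) (ρ / 2) ⊆ Λ.Ω
  hΩE : Λ.Ω ⊆ Λ.E.carrier
  hΩcc : IsConnected Λ.Ωᶜ
  hfar : Λ.Dτ \ (⋃ i : Fin 2, closedBall (D.pt i - Λ.τ) rs) ⊆ Λ.Ω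
  hΩD : Λ.Ω ⊆ Λ.Dτ
  hΩX : Disjoint Λ.Ω (Λ.XS ∪ Λ.XT)
  hEΩ : (Λ.E.carrier \ Λ.Ω).Nonempty
  hb₀ : Λ.b₀ ∈ Λ.Ω
  -- the outer sequence
  hEn : ∀ m, Λ.E.IsHullSubdomain (En m)
  hmono : Monotone fun m => φ.pullbackHull (En m)
  hsub : ∀ m, φ.pullbackHull (En m) ⊆ closure (upperHalfPlaneSet \ φ.symm '' Λ.Ω)
  hker : ∀ W : Set ℂ, IsOpen W → IsPreconnected W → W ⊆ ⋂ m, upperHalfPlaneSet \ φ.pullbackHull (En m) →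
    (W ∩ (upperHalfPlaneSet \ closure (upperHalfPlaneSet \ φ.symm '' Λ.Ω))).Nonempty →
    W ⊆ upperHalfPlaneSet \ closure (upperHalfPlaneSet \ φ.symm '' Λ.Ω)
  hAstar : IsStarHull (closure (upperHalfPlaneSet \ φ.symm '' Λ.Ω))
  hΩEn : ∀ m, Λ.Ω ⊆ (En m).carrier
  -- the reach data
  htz : ∀ m, 0 < tz m ∧ tz m ≤ ρ / 128
  htz25 : ∀ m, ∀ᶠ j in atTop, 25 * δ (κ j) < tz m
  hV : ∀ m (i : Fin 2), pathComponentIn (gateV (Λ.Pv i) ρ (tz m)) (Λ.Pv i + ((ρ / 16 : ℝ) : ℂ) * Complex.I) ⊆ Λ.E.carrier \ Zc m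
  hbase : ∀ i : Fin 2, Λ.Pv i + ((ρ / 16 : ℝ) : ℂ) * Complex.I ∈ Λ.Ω
  hGEn : ∀ m, connectedComponentIn (Λ.E.carrier \ Zc m) Λ.b₀ ⊆ (En m).carrier
  hΩG : ∀ m, Λ.Ω ⊆ connectedComponentIn (Λ.E.carrier \ Zc m) Λ.b₀
  hZfar : ∀ m, ∀ᶠ j in atTop, ∀ v : HexVertex, v ∉ S (κ j) (n (κ j)) ∪ T (κ j) (n' (κ j)) →
    ((δ (κ j) : ℝ) : ℂ) * hexCenter v ∈ closure D.carrier → ∀ z : ℂ,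
      dist z (((δ (κ j) : ℝ) : ℂ) * hexCenter v - ((δ (κ j) : ℝ) : ℂ) * triEmbed (Λ.x j)) ≤ 25 * δ (κ j) → z ∉ Zc m

/-- **Registered carrier `stub_carvedReduction_outerData`** (crux item stmt-CriticalPhenomena-10472, stub
T-A′₂F `stub_carvedReduction_squeezeGeometry_domainsCoreF`, piece THE OUTER DATA): the union of the
compact convex family is the union of the closed cells. -/
theorem stub_carvedReduction_outerData {D : DobrushinDomain} {a b : ℝ → HexVertex} {δ : ℕ → ℝ}
    {S T : ℕ → ℕ → Set HexVertex} {n n' : ℕ → ℕ} {q q' : ℕ → HexVertex} {κ : ℕ → ℕ} {ρ R : ℝ} {N : ℕ}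
    (Λ : SqueezeLimit D a b δ S T n n' q q' κ ρ R N) : (⋃ k, Λ.Kf k) = Λ.XS ∪ Λ.XT :=
  Λ.iUnion_Kf

end Summit.CriticalPhenomena.SAWScalingLimit.Theorems.ObservableToSLE.TypeLadder

end
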